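import Literature.NumberTheory.Sieve.MaynardSieveCounting2
import Literature.NumberTheory.Sieve.MaynardSieveLemma51
import Literature.NumberTheory.LFunctions.PrimeNumberTheoremErrorTermProofs
import HarnessLib

/-!
# Maynard 2015, Lemma 5.2: the asymptotic bookkeeping (`maynard_lemma52_holds`)

J. Maynard, *Small gaps between primes*, Ann. of Math. (2) 181 (2015), 383–413 = arXiv:1311.4600v3,
Lemma 5.2 (p. 10): for the weights `λ_d` of Proposition 4.1 and `1 ≤ m ≤ k`,
`S₂^{(m)} = X_N/φ(W) · Σ_r (y^{(m)}_r)²/∏ g(rᵢ) + O((y^{(m)}_max)² φ(W)^{k−2} N (log N)^{k−2}/(W^{k−1} D₀)) + O(y_max² N/(log N)^A)`,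
and in the proof of Lemma 6.3 (p. 14) `X_N` is evaluated by the prime number theorem. The tree's
named fact `Literature.NumberTheory.Sieve.maynard_lemma52` (`MaynardSieveS2.lean`) is this statement with `X_N` already
replaced by `N/log N`.

This file is the sequel of `MaynardSieveCounting2.lean`, whose `abs_maynardS2_sub_main_le` is the
non-asymptotic form of Lemma 5.2 ((5.16)–(5.26) with explicit error weights). Here the error
weights are estimated along `N → ∞` (`R = N^{θ/2−δ}`, `W = ∏_{p ≤ D₀} p`, `D₀ = ⌊log log log N⌋`)
and the named fact is DISCHARGED. Everything in this file is PROVED (theorems only):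

* `exists_eventually_abs_primesX_sub_le` — `X_N = π(2N + h_m − 1) − π(N + h_m − 1) = N/log N + O(N/log² N)`,
  from `ϑ(x) = x + O(x/log² x)` (the tree's `Literature.NumberTheory.LFunctions.ChebyshevThetaDeLaValleePoussin_holds`,
  `PrimeNumberTheoremErrorTermProofs.lean`) and the sandwich
  `#{a < p ≤ b}·log(a+1) ≤ ϑ(b) − ϑ(a) ≤ #{a < p ≤ b}·log b`;
* `exists_eventually_level_sum_le` — the level-of-distribution hypothesis
  (`MaynardPrimesHaveLevel θ`, in the weighted form `MaynardPrimesHaveLevel.isBigO_sum_pow_omega_mul`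
  of `MaynardSieveLevel.lean`) applied at `x = X₂ = 2N + h_m − 1` and `x = X₁ = N + h_m − 1`, the
  moduli `q ≤ W⌊R⌋²` lying below `X₁^θ` for large `N` ("since `R²W ≤ N^θ (log N)^{−C}`", p. 11);
* `eventually_sum_inv_totient_le`, `eventually_Zg_pow_sub_one_le` — `L ≪ (φ(W)/W) log R` and
  `Z_g^K − 1 ≪ 1/D₀` (from `CoprimeSquarefreeSums`/`CoprimeSquarefreeSumsBounds`), the sizes of the
  one-variable sums entering (5.19)–(5.20) and the bound `λ_max ≪ y_max L^{2k}`;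
* `eventually_maynardD0_le_log`, `eventually_dvd_maynardW_of_dvd_sub`,
  `eventually_floor_maynardR_lt` — `D₀ ≤ log N`, "`p ∣ hᵢ − hⱼ ⇒ p ∣ W`" for distinct shifts, and
  `⌊R⌋ < N + h_m`;
* `lemma52_term1_le`, `lemma52_term2_le`, `lemma52_term3_le`, `lemma52_combine` — the real-number
  bookkeeping; `sum_maynardYm_sq_div_bounds` — `0 ≤ Σ_r (y^{(m)}_r)²/∏ g(rᵢ) ≤ Y² L_g^{k−1}`;
* `maynard_lemma52_holds : maynard_lemma52`.

After this file and `MaynardSieveLemma63Sum.lean`, the `S₂` half of Proposition 4.1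
(`maynard_S2_asymptotic`, via `maynard_S2_asymptotic_of` of `MaynardSieveS2.lean`) rests on the
single named fact `maynard_lemma63_ym` (the evaluation of `y^{(m)}`, Lemma 5.3 + Lemma 6.1).

## References

* J. Maynard, *Small gaps between primes*, Ann. of Math. (2) 181 (2015), 383–413,
  doi:10.4007/annals.2015.181.1.7 = arXiv:1311.4600v3; Lemma 5.2 and its proof, pp. 10–11, and the
  evaluation of `X_N` in the proof of Lemma 6.3, p. 14. [cite: MaynardAnnals2015]
-/

open Finset Filter Asymptotics

open scoped ArithmeticFunction.omega

namespace Literature.NumberTheory.Sieve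
namespace MaynardSieve

/-! ### Primes in `(a, b]`: counting with `π` and weighing with `ϑ` -/

/-- `ϑ(b) − ϑ(a) = Σ_{a < p ≤ b} log p` for naturals `a ≤ b`. [folklore] -/
theorem theta_sub_theta_eq_sum {a b : ℕ} (hab : a ≤ b) :
    Chebyshev.theta b - Chebyshev.theta a = ∑ p ∈ (Finset.Ioc a b).filter Nat.Prime, Real.log p := by
  rw [Chebyshev.theta, Chebyshev.theta, Nat.floor_natCast, Nat.floor_natCast, sub_eq_iff_eq_add',
    ← Finset.sum_union]
  · congr 1
    rw [← Finset.filter_union, Finset.Ioc_union_Ioc_eq_Ioc (Nat.zero_le a) hab]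
  · exact Finset.disjoint_filter_filter (Finset.Ioc_disjoint_Ioc_of_le le_rfl)

/-- The sandwich `#{a < p ≤ b} log(a+1) ≤ ϑ(b) − ϑ(a) ≤ #{a < p ≤ b} log b`. [folklore] -/
theorem card_mul_log_le_sum {a b : ℕ} :
    (((Finset.Ioc a b).filter Nat.Prime).card : ℝ) * Real.log (a + 1) ≤
      ∑ p ∈ (Finset.Ioc a b).filter Nat.Prime, Real.log p := by
  rw [← nsmul_eq_mul, ← Finset.sum_const]
  refine Finset.sum_le_sum fun p hp => ?_
  have hp' := (Finset.mem_Ioc.1 (Finset.mem_filter.1 hp).1)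
  have h1 : (a : ℝ) + 1 ≤ p := by exact_mod_cast hp'.1
  exact Real.log_le_log (by positivity) h1

/-- See `card_mul_log_le_sum`. [folklore] -/
theorem sum_le_card_mul_log {a b : ℕ} :
    ∑ p ∈ (Finset.Ioc a b).filter Nat.Prime, Real.log p ≤
      (((Finset.Ioc a b).filter Nat.Prime).card : ℝ) * Real.log b := by
  rw [← nsmul_eq_mul, ← Finset.sum_const]
  refine Finset.sum_le_sum fun p hp => ?_
  have hp' := (Finset.mem_Ioc.1 (Finset.mem_filter.1 hp).1)
  have h0 : (0 : ℝ) < p := by exact_mod_cast (show 0 < p by omega)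
  exact Real.log_le_log h0 (by exact_mod_cast hp'.2)

/-- **`X_N = N/log N + O(N/log² N)`** for the number `X_N` of primes in `(N + h_m − 1, 2N + h_m − 1]`
(an interval of length exactly `N`), from the prime number theorem with the de la Vallée Poussin
error term (`ϑ(x) = x + O(x/log² x)`, the tree's `Literature.NumberTheory.LFunctions.ChebyshevThetaDeLaValleePoussin_holds`) and the
sandwich `#·log(X₁ + 1) ≤ ϑ(X₂) − ϑ(X₁) ≤ #·log X₂` (Maynard's "`X_N`", Lemma 5.2, evaluated by "the
prime number theorem" in the proof of Lemma 6.3). [cite: MaynardAnnals2015, Lemma 5.2 (X_N) and proof of Lemma 6.3] -/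
theorem exists_eventually_abs_primesX_sub_le {k : ℕ} (h : Fin k → ℤ) (m : Fin k) :
    ∃ C : ℝ, ∀ᶠ N : ℕ in atTop,
      |(primesX h N m : ℝ) - N / Real.log N| ≤ C * N / Real.log N ^ 2 := by
  obtain ⟨C, hC'⟩ := LFunctions.ChebyshevThetaDeLaValleePoussin_holds.logPow 2
  have hC : ∀ x : ℝ, 2 ≤ x → |Chebyshev.theta x - x| ≤ C * x / Real.log x ^ 2 := fun x hx => by
    have := hC' x hx
    rwa [Real.rpow_two] at this
  have hC0 : 0 ≤ C := by
    have h2 := (abs_nonneg _).trans (hC 2 le_rfl)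
    have hl : 0 < Real.log 2 := Real.log_pos (by norm_num)
    have hpos : (0 : ℝ) < 2 / Real.log 2 ^ 2 := by positivity
    rw [mul_div_assoc] at h2
    by_contra hneg
    push Not at hneg
    have := mul_neg_of_neg_of_pos hneg hpos
    linarith
  refine ⟨18 * C + 2, ?_⟩
  have hlog : Tendsto (fun N : ℕ => Real.log N) atTop atTop :=
    Real.tendsto_log_atTop.comp tendsto_natCast_atTop_atTop
  filter_upwards [eventually_ge_atTop (2 * (h m).natAbs + 8), hlog.eventually_ge_atTop 4] with N hN hL
  -- notation and the ranges of the endpoints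
  set L := Real.log N with hLdef
  have hNpos : (0 : ℝ) < N := by exact_mod_cast (show 0 < N by omega)
  have hHabs : |((h m : ℤ) : ℝ)| ≤ (N : ℝ) / 2 - 4 := by
    have h2 : (2 * (h m).natAbs + 8 : ℕ) ≤ (N : ℝ) := by exact_mod_cast hN
    push_cast at h2
    rw [← Int.cast_abs, ← Nat.cast_natAbs]
    linarith
  obtain ⟨hHlo, hHhi⟩ := abs_le.1 hHabs
  have hz1 : (0 : ℤ) ≤ (N : ℤ) + h m - 1 := by
    have : (0 : ℝ) ≤ (N : ℝ) + (h m : ℝ) - 1 := by linarith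
    exact_mod_cast this
  have hz2 : (0 : ℤ) ≤ 2 * (N : ℤ) + h m - 1 := by omega
  have hX1R : ((X1 h N m : ℕ) : ℝ) = (N : ℝ) + (h m : ℝ) - 1 := by
    have : ((X1 h N m : ℕ) : ℤ) = (N : ℤ) + h m - 1 := Int.toNat_of_nonneg hz1
    exact_mod_cast this
  have hX2R : ((X2 h N m : ℕ) : ℝ) = 2 * (N : ℝ) + (h m : ℝ) - 1 := by
    have : ((X2 h N m : ℕ) : ℤ) = 2 * (N : ℤ) + h m - 1 := Int.toNat_of_nonneg hz2
    exact_mod_cast this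
  have hX12 : X1 h N m ≤ X2 h N m := X1_le_X2 h N m
  have hX1lo : (N : ℝ) / 2 ≤ ((X1 h N m : ℕ) : ℝ) := by rw [hX1R]; linarith
  have hX1hi : ((X1 h N m : ℕ) : ℝ) ≤ 3 / 2 * (N : ℝ) := by rw [hX1R]; linarith
  have hX2hi : ((X2 h N m : ℕ) : ℝ) ≤ 3 * (N : ℝ) := by rw [hX2R]; linarith
  have hdiff : ((X2 h N m : ℕ) : ℝ) - ((X1 h N m : ℕ) : ℝ) = N := by rw [hX1R, hX2R]; ring
  have hN16 : (16 : ℝ) ≤ N := by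
    -- from `log N ≥ 4`: `N ≥ e^4 ≥ 2^4`
    have h4 : Real.exp 4 ≤ N := by
      have := Real.exp_le_exp.2 hL
      rwa [hLdef, Real.exp_log hNpos] at this
    have h16 : (16 : ℝ) ≤ Real.exp 4 := by
      have he : Real.exp 4 = Real.exp 1 ^ 4 := by rw [← Real.exp_nat_mul]; norm_num
      have h2 : (2 : ℝ) ≤ Real.exp 1 := by have := Real.exp_one_gt_d9; linarith
      rw [he]
      calc (16 : ℝ) = 2 ^ 4 := by norm_num
        _ ≤ Real.exp 1 ^ 4 := pow_le_pow_left₀ (by norm_num) h2 4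
    linarith
  have hX1two : (2 : ℝ) ≤ ((X1 h N m : ℕ) : ℝ) := by linarith
  have hX2two : (2 : ℝ) ≤ ((X2 h N m : ℕ) : ℝ) := by linarith [hdiff]
  -- logarithms: `log(X₁+1) ≥ L − 1`, `log X₁ ≥ L − 1`, `log X₂ ≤ L + 2`
  have hlog2 : Real.log 2 ≤ 1 := by have := Real.log_two_lt_d9; linarith
  have hlog3 : Real.log 3 ≤ 2 := by
    have : Real.log 3 ≤ Real.log 4 := Real.log_le_log (by norm_num) (by norm_num)
    have h4 : Real.log 4 = 2 * Real.log 2 := by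
      rw [show (4 : ℝ) = 2 ^ 2 by norm_num, Real.log_pow]; ring
    linarith
  have hlogX1 : L - 1 ≤ Real.log ((X1 h N m : ℕ) : ℝ) := by
    have : Real.log ((N : ℝ) / 2) ≤ Real.log ((X1 h N m : ℕ) : ℝ) := Real.log_le_log (by positivity) hX1lo
    rw [Real.log_div hNpos.ne' (by norm_num)] at this
    linarith
  have hlogX1' : L - 1 ≤ Real.log (((X1 h N m : ℕ) : ℝ) + 1) := by
    have : Real.log ((X1 h N m : ℕ) : ℝ) ≤ Real.log (((X1 h N m : ℕ) : ℝ) + 1) :=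
      Real.log_le_log (by linarith) (by linarith)
    linarith
  have hlogX2 : Real.log ((X2 h N m : ℕ) : ℝ) ≤ L + 2 := by
    have : Real.log ((X2 h N m : ℕ) : ℝ) ≤ Real.log (3 * (N : ℝ)) := Real.log_le_log (by linarith) hX2hi
    rw [Real.log_mul (by norm_num) hNpos.ne'] at this
    linarith
  have hlogX2lo : L - 1 ≤ Real.log ((X2 h N m : ℕ) : ℝ) :=
    hlogX1.trans (Real.log_le_log (by linarith) (by linarith [hdiff]))
  have hL1 : (3 : ℝ) ≤ L - 1 := by linarith
  -- the PNT error on `ϑ(X₂) − ϑ(X₁) − N`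
  have hinv : ∀ y : ℝ, L - 1 ≤ y → 1 / y ^ 2 ≤ 2 / L ^ 2 := by
    intro y hy
    have hy0 : 0 < y := by linarith
    rw [div_le_div_iff₀ (by positivity) (by positivity)]
    nlinarith
  have hE2 : |Chebyshev.theta ((X2 h N m : ℕ) : ℝ) - ((X2 h N m : ℕ) : ℝ)| ≤ 6 * C * N / L ^ 2 := by
    refine (hC _ hX2two).trans ?_
    calc C * ((X2 h N m : ℕ) : ℝ) / Real.log ((X2 h N m : ℕ) : ℝ) ^ 2
        = C * ((X2 h N m : ℕ) : ℝ) * (1 / Real.log ((X2 h N m : ℕ) : ℝ) ^ 2) := by ring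
      _ ≤ C * (3 * N) * (2 / L ^ 2) :=
          mul_le_mul (mul_le_mul_of_nonneg_left hX2hi hC0) (hinv _ hlogX2lo) (by positivity) (by positivity)
      _ = 6 * C * N / L ^ 2 := by ring
  have hE1 : |Chebyshev.theta ((X1 h N m : ℕ) : ℝ) - ((X1 h N m : ℕ) : ℝ)| ≤ 3 * C * N / L ^ 2 := by
    refine (hC _ hX1two).trans ?_
    calc C * ((X1 h N m : ℕ) : ℝ) / Real.log ((X1 h N m : ℕ) : ℝ) ^ 2
        = C * ((X1 h N m : ℕ) : ℝ) * (1 / Real.log ((X1 h N m : ℕ) : ℝ) ^ 2) := by ring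
      _ ≤ C * (3 / 2 * N) * (2 / L ^ 2) :=
          mul_le_mul (mul_le_mul_of_nonneg_left hX1hi hC0) (hinv _ hlogX1) (by positivity) (by positivity)
      _ = 3 * C * N / L ^ 2 := by ring
  obtain ⟨S, hSdef⟩ : ∃ S : ℝ, S = ∑ p ∈ (Finset.Ioc (X1 h N m) (X2 h N m)).filter Nat.Prime, Real.log p :=
    ⟨_, rfl⟩
  have hS : S = Chebyshev.theta ((X2 h N m : ℕ) : ℝ) - Chebyshev.theta ((X1 h N m : ℕ) : ℝ) := by
    rw [hSdef]; exact (theta_sub_theta_eq_sum hX12).symm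
  obtain ⟨E, hEdef⟩ : ∃ E : ℝ, E = 9 * C * N / L ^ 2 := ⟨_, rfl⟩
  have hE0 : 0 ≤ E := by rw [hEdef]; positivity
  have hSN : |S - N| ≤ E := by
    rw [hS, hEdef]
    calc |Chebyshev.theta ((X2 h N m : ℕ) : ℝ) - Chebyshev.theta ((X1 h N m : ℕ) : ℝ) - N|
        = |(Chebyshev.theta ((X2 h N m : ℕ) : ℝ) - ((X2 h N m : ℕ) : ℝ)) -
            (Chebyshev.theta ((X1 h N m : ℕ) : ℝ) - ((X1 h N m : ℕ) : ℝ))| := by rw [← hdiff]; ring_nf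
      _ ≤ _ := abs_sub _ _
      _ ≤ 6 * C * N / L ^ 2 + 3 * C * N / L ^ 2 := add_le_add hE2 hE1
      _ = 9 * C * N / L ^ 2 := by ring
  obtain ⟨hSlo, hShi⟩ := abs_le.1 hSN
  -- the count
  obtain ⟨c, hcdef⟩ : ∃ c : ℝ, c = (((Finset.Ioc (X1 h N m) (X2 h N m)).filter Nat.Prime).card : ℝ) :=
    ⟨_, rfl⟩
  have hcX : (primesX h N m : ℝ) = c := by
    -- `π(X₂) − π(X₁) = #{X₁ < p ≤ X₂}` (the tree has this identity in general form as
    -- `Literature.NumberTheory.Sieve.MaynardTao.primeCounting_sub_eq`, `MaynardSieveTupleTerms.lean`, not imported here)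
    have hπ : ∀ n : ℕ, Nat.primeCounting n = ((Finset.range (n + 1)).filter Nat.Prime).card :=
      fun n => by rw [Nat.primeCounting, Nat.primeCounting', Nat.count_eq_card_filter_range]
    have hcount : Nat.primeCounting (X2 h N m) - Nat.primeCounting (X1 h N m) =
        ((Finset.Ioc (X1 h N m) (X2 h N m)).filter Nat.Prime).card := by
      rw [hπ, hπ]
      have hsub : (Finset.range (X1 h N m + 1)).filter Nat.Prime ⊆
          (Finset.range (X2 h N m + 1)).filter Nat.Prime :=
        Finset.filter_subset_filter _ (Finset.range_mono (by omega))
      rw [← Finset.card_sdiff_of_subset hsub]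
      congr 1
      ext p
      rw [Finset.mem_sdiff, Finset.mem_filter, Finset.mem_filter, Finset.mem_filter, Finset.mem_range,
        Finset.mem_range, Finset.mem_Ioc, Nat.lt_succ_iff, Nat.lt_succ_iff]
      constructor
      · rintro ⟨⟨h1, h2⟩, h3⟩
        refine ⟨⟨?_, h1⟩, h2⟩
        by_contra hle
        push Not at hle
        exact h3 ⟨hle, h2⟩
      · rintro ⟨⟨h1, h2⟩, h3⟩
        exact ⟨⟨h2, h3⟩, fun hc => absurd hc.1 (by omega)⟩
    rw [hcdef, primesX, hcount]
  have hc0 : 0 ≤ c := by rw [hcdef]; exact Nat.cast_nonneg _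
  have hup : c * (L - 1) ≤ S := by
    calc c * (L - 1) ≤ c * Real.log (((X1 h N m : ℕ) : ℝ) + 1) := by gcongr
      _ ≤ S := by rw [hcdef, hSdef]; exact card_mul_log_le_sum
  have hdown : S ≤ c * (L + 2) := by
    calc S ≤ c * Real.log ((X2 h N m : ℕ) : ℝ) := by rw [hcdef, hSdef]; exact sum_le_card_mul_log
      _ ≤ c * (L + 2) := by gcongr
  have hLpos : 0 < L := by linarith
  have hL2 : L * L ≤ L * (L + 2) := mul_le_mul_of_nonneg_left (by linarith) (by linarith)
  have hEL : E / L ≤ 9 * C * (N / L ^ 2) := by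
    rw [hEdef, show 9 * C * (N : ℝ) / L ^ 2 = 9 * C * (N / L ^ 2) by ring]
    exact div_le_self (by positivity) (by linarith)
  have hNL2 : 0 ≤ (N : ℝ) / L ^ 2 := by positivity
  have hCN : 0 ≤ C * ((N : ℝ) / L ^ 2) := mul_nonneg hC0 hNL2
  have htarget : (18 * C + 2) * N / L ^ 2 = 18 * (C * (N / L ^ 2)) + 2 * (N / L ^ 2) := by ring
  -- lower bound: `c ≥ (N − E)/(L + 2)`
  have hlow : N / L - c ≤ (18 * C + 2) * N / L ^ 2 := by
    have h1 : (N - E) / (L + 2) ≤ c := by rw [div_le_iff₀ (by positivity)]; linarith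
    have eq1 : N / L - (N - E) / (L + 2) = (2 * N + L * E) / (L * (L + 2)) := by
      field_simp
      ring
    have h2 : (2 * N + L * E) / (L * (L + 2)) ≤ (2 * N + L * E) / (L * L) :=
      div_le_div_of_nonneg_left (by positivity) (by positivity) hL2
    have eq2 : (2 * N + L * E) / (L * L) = 2 * (N / L ^ 2) + E / L := by
      field_simp
    rw [htarget]
    calc N / L - c ≤ N / L - (N - E) / (L + 2) := by linarith
      _ ≤ 2 * (N / L ^ 2) + E / L := by rw [eq1]; exact h2.trans (le_of_eq eq2)
      _ ≤ _ := by linarith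
  -- upper bound: `c ≤ (N + E)/(L − 1)`
  have hupp : c - N / L ≤ (18 * C + 2) * N / L ^ 2 := by
    have h1 : c ≤ (N + E) / (L - 1) := by rw [le_div_iff₀ (by linarith)]; linarith
    have eq1 : (N + E) / (L - 1) - N / L = (L * E + N) / (L * (L - 1)) := by
      field_simp
      ring
    have hden : L * L / 2 ≤ L * (L - 1) := by
      have : L / 2 ≤ L - 1 := by linarith
      calc L * L / 2 = L * (L / 2) := by ring
        _ ≤ L * (L - 1) := mul_le_mul_of_nonneg_left this hLpos.le
    have h2 : (L * E + N) / (L * (L - 1)) ≤ (L * E + N) / (L * L / 2) :=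
      div_le_div_of_nonneg_left (by positivity) (by positivity) hden
    have eq2 : (L * E + N) / (L * L / 2) = 2 * (E / L) + 2 * (N / L ^ 2) := by
      field_simp
    rw [htarget]
    calc c - N / L ≤ (N + E) / (L - 1) - N / L := by linarith
      _ ≤ 2 * (E / L) + 2 * (N / L ^ 2) := by rw [eq1]; exact h2.trans (le_of_eq eq2)
      _ ≤ _ := by linarith
  rw [hcX, abs_le]
  exact ⟨by linarith, hupp⟩


/-! ### The endpoints `X₁ = N + h_m − 1 ≥ N/2`, `X₂ = 2N + h_m − 1 ≤ 3N` -/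

/-- For `N ≥ 2|h_m| + 2`: `N/2 ≤ X₁ ≤ 3N/2`, `X₂ ≤ 3N`, `X₂ − X₁ = N` (as reals). [folklore] -/
theorem X1_X2_bounds {k : ℕ} (h : Fin k → ℤ) (m : Fin k) {N : ℕ} (hN : 2 * (h m).natAbs + 2 ≤ N) :
    (N : ℝ) / 2 ≤ ((X1 h N m : ℕ) : ℝ) ∧ ((X1 h N m : ℕ) : ℝ) ≤ 3 / 2 * (N : ℝ) ∧
      ((X2 h N m : ℕ) : ℝ) ≤ 3 * (N : ℝ) ∧ ((X2 h N m : ℕ) : ℝ) - ((X1 h N m : ℕ) : ℝ) = N := by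
  have hHabs : |((h m : ℤ) : ℝ)| ≤ (N : ℝ) / 2 - 1 := by
    have h2 : (2 * (h m).natAbs + 2 : ℕ) ≤ (N : ℝ) := by exact_mod_cast hN
    push_cast at h2
    rw [← Int.cast_abs, ← Nat.cast_natAbs]
    linarith
  obtain ⟨hHlo, hHhi⟩ := abs_le.1 hHabs
  have hz1 : (0 : ℤ) ≤ (N : ℤ) + h m - 1 := by
    have : (0 : ℝ) ≤ (N : ℝ) + (h m : ℝ) - 1 := by linarith
    exact_mod_cast this
  have hz2 : (0 : ℤ) ≤ 2 * (N : ℤ) + h m - 1 := by omega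
  have hX1R : ((X1 h N m : ℕ) : ℝ) = (N : ℝ) + (h m : ℝ) - 1 := by
    have : ((X1 h N m : ℕ) : ℤ) = (N : ℤ) + h m - 1 := Int.toNat_of_nonneg hz1
    exact_mod_cast this
  have hX2R : ((X2 h N m : ℕ) : ℝ) = 2 * (N : ℝ) + (h m : ℝ) - 1 := by
    have : ((X2 h N m : ℕ) : ℤ) = 2 * (N : ℤ) + h m - 1 := Int.toNat_of_nonneg hz2
    exact_mod_cast this
  refine ⟨by rw [hX1R]; linarith, by rw [hX1R]; linarith, by rw [hX2R]; linarith, by rw [hX1R, hX2R]; ring⟩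

/-- `X₁(N), X₂(N) → ∞`. [folklore] -/
theorem tendsto_X1_atTop {k : ℕ} (h : Fin k → ℤ) (m : Fin k) :
    Tendsto (fun N : ℕ => ((X1 h N m : ℕ) : ℝ)) atTop atTop := by
  refine tendsto_atTop_mono' atTop ?_ ((tendsto_natCast_atTop_atTop (R := ℝ)).atTop_div_const (by norm_num : (0:ℝ) < 2))
  filter_upwards [eventually_ge_atTop (2 * (h m).natAbs + 2)] with N hN
  exact (X1_X2_bounds h m hN).1

/-- See `tendsto_X1_atTop`. [folklore] -/
theorem tendsto_X2_atTop {k : ℕ} (h : Fin k → ℤ) (m : Fin k) :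
    Tendsto (fun N : ℕ => ((X2 h N m : ℕ) : ℝ)) atTop atTop := by
  refine tendsto_atTop_mono' atTop ?_ (tendsto_X1_atTop h m)
  filter_upwards with N
  exact_mod_cast X1_le_X2 h N m

/-- `x/(log x)^{A} ≤ 3 · 2^{A} N/(log N)^{A}` for `N/2 ≤ x ≤ 3N`, `N ≥ 4` (`log x ≥ log N − log 2 ≥ (log N)/2`).
[folklore] -/
theorem div_log_rpow_le {A : ℝ} (hA : 0 ≤ A) {N x : ℝ} (hN : 4 ≤ N) (hx1 : N / 2 ≤ x) (hx2 : x ≤ 3 * N) :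
    x / Real.log x ^ A ≤ 3 * 2 ^ A * N / Real.log N ^ A := by
  have hNpos : 0 < N := by linarith
  have hxpos : 0 < x := by linarith
  have hlog2 : Real.log 2 ≤ Real.log N / 2 := by
    have : Real.log 4 ≤ Real.log N := Real.log_le_log (by norm_num) hN
    have h4 : Real.log 4 = 2 * Real.log 2 := by
      rw [show (4 : ℝ) = 2 ^ 2 by norm_num, Real.log_pow]; ring
    linarith
  have hlogN : 0 < Real.log N := Real.log_pos (by linarith)
  have hlogx : Real.log N / 2 ≤ Real.log x := by
    have : Real.log (N / 2) ≤ Real.log x := Real.log_le_log (by positivity) hx1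
    rw [Real.log_div hNpos.ne' (by norm_num)] at this
    linarith
  have hden : (Real.log N / 2) ^ A ≤ Real.log x ^ A := Real.rpow_le_rpow (by positivity) hlogx hA
  have hden0 : 0 < (Real.log N / 2) ^ A := Real.rpow_pos_of_pos (by positivity) _
  calc x / Real.log x ^ A ≤ 3 * N / (Real.log N / 2) ^ A := by
        rw [div_le_div_iff₀ (hden0.trans_le hden) hden0]
        exact mul_le_mul hx2 hden (hden0.le) (by positivity)
    _ = 3 * 2 ^ A * N / Real.log N ^ A := by
        rw [Real.div_rpow hlogN.le (by norm_num)]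
        field_simp

/-! ### The level-of-distribution input at the two endpoints -/

/-- **The error term of Lemma 5.2 via the level of distribution** (Maynard 2015, proof of Lemma 5.2,
pp. 10–11): if the primes have level of distribution `θ` in Maynard's sense, then for every `K ≥ 0` and
`A > 0` there is `C` with, for all large `N`,
`Σ_{q ≤ W⌊R⌋², q squarefree} K^{ω(q)} (E(X₂; q) + E(X₁; q)) ≤ C N/(log N)^{A}`
(`R = N^{θ/2−δ}`, `W = ∏_{p ≤ D₀} p`, so that `W ⌊R⌋² ≤ X₁^θ` for large `N`; the hypothesis is applied
at `x = X₂ = 2N + h_m − 1` and `x = X₁ = N + h_m − 1`). [cite: MaynardAnnals2015, proof of Lemma 5.2 (the level-of-distribution step, pp. 10–11)] -/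
theorem exists_eventually_level_sum_le {k : ℕ} (h : Fin k → ℤ) (m : Fin k) {θ δ : ℝ} (hδ : 0 < δ)
    (hη : 0 < θ / 2 - δ) (hlev : MaynardPrimesHaveLevel θ) {K : ℝ} (hK : 0 ≤ K) {A : ℝ} (hA : 0 < A) :
    ∃ C : ℝ, ∀ᶠ N : ℕ in atTop,
      ∑ q ∈ (Finset.Icc 1 (maynardW N * (⌊maynardR θ δ N⌋₊ * ⌊maynardR θ δ N⌋₊))).filter Squarefree,
          K ^ ω q * (primeCountingAPErr ((X2 h N m : ℕ) : ℝ) q + primeCountingAPErr ((X1 h N m : ℕ) : ℝ) q) ≤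
        C * N / Real.log N ^ A := by
  have hθ1 : θ ≤ 1 := hlev.le_one
  have hθ0 : 0 < θ := by linarith
  obtain ⟨c, hcpos, hc⟩ := (hlev.isBigO_sum_pow_omega_mul hK hA).exists_pos
  rw [IsBigOWith] at hc
  -- the hypothesis as a pointwise bound for large real `x`
  have hP : ∀ᶠ x : ℝ in atTop, ∑ q ∈ Icc 1 ⌊x ^ θ⌋₊, K ^ ω q * primeCountingAPErr x q ≤
      c * (x / Real.log x ^ A) := by
    filter_upwards [hc, eventually_ge_atTop (2 : ℝ)] with x hx hx2
    have hlog : 0 < Real.log x := Real.log_pos (by linarith)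
    rwa [Real.norm_of_nonneg (Finset.sum_nonneg fun q _ => mul_nonneg (pow_nonneg hK _)
      (primeCountingAPErr_nonneg _ _)), Real.norm_of_nonneg (by positivity)] at hx
  have hP2 := (tendsto_X2_atTop h m).eventually hP
  have hP1 := (tendsto_X1_atTop h m).eventually hP
  -- `2 · 4^{D₀} ≤ log N ≤ N^{2δ}` eventually
  have h4 := (isLittleO_pow_maynardD0_log (b := (4 : ℝ)) (by norm_num)).bound (show (0:ℝ) < 1 / 2 by norm_num)
  have hlogpow := eventually_mul_log_pow_le_rpow 1 1 (show (0 : ℝ) < 2 * δ by linarith)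
  refine ⟨2 * c * (3 * 2 ^ A), ?_⟩
  filter_upwards [hP2, hP1, h4, hlogpow, eventually_ge_atTop (2 * (h m).natAbs + 4),
    (Real.tendsto_log_atTop.comp tendsto_natCast_atTop_atTop).eventually_ge_atTop (2 : ℝ)]
    with N hN2 hN1 h4N hlogpowN hN hlogN2
  have hlogN2' : 2 ≤ Real.log N := hlogN2
  obtain ⟨hX1lo, -, hX2hi, hdiff⟩ := X1_X2_bounds h m (by omega : 2 * (h m).natAbs + 2 ≤ N)
  have hN4 : (4 : ℝ) ≤ N := by
    have : (2 * (h m).natAbs + 4 : ℕ) ≤ (N : ℝ) := by exact_mod_cast hN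
    push_cast at this
    linarith
  have hNpos : (0 : ℝ) < N := by linarith
  have hX1hi' : ((X1 h N m : ℕ) : ℝ) ≤ 3 * N := by linarith [hdiff, hX2hi]
  have hX2lo : (N : ℝ) / 2 ≤ ((X2 h N m : ℕ) : ℝ) := by linarith [hdiff]
  -- `Q = W⌊R⌋² ≤ X₁^θ ≤ X₂^θ`
  set Q := maynardW N * (⌊maynardR θ δ N⌋₊ * ⌊maynardR θ δ N⌋₊) with hQ
  have hQ1 : (Q : ℝ) ≤ ((X1 h N m : ℕ) : ℝ) ^ θ := by
    have hW4 : (maynardW N : ℝ) ≤ 4 ^ maynardD0 N := maynardW_le_four_pow N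
    have hRpos : 0 ≤ maynardR θ δ N := by unfold maynardR; positivity
    have hfl : (⌊maynardR θ δ N⌋₊ : ℝ) ≤ maynardR θ δ N := Nat.floor_le hRpos
    have hR2 : (⌊maynardR θ δ N⌋₊ : ℝ) * ⌊maynardR θ δ N⌋₊ ≤ (N : ℝ) ^ (θ - 2 * δ) := by
      calc (⌊maynardR θ δ N⌋₊ : ℝ) * ⌊maynardR θ δ N⌋₊ ≤ maynardR θ δ N * maynardR θ δ N :=
            mul_le_mul hfl hfl (Nat.cast_nonneg _) hRpos
        _ = (N : ℝ) ^ (θ - 2 * δ) := by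
            unfold maynardR
            rw [← Real.rpow_add hNpos]; ring_nf
    have h4' : 2 * (4 : ℝ) ^ maynardD0 N ≤ Real.log N := by
      have := h4N
      rw [Real.norm_of_nonneg (by positivity), Real.norm_of_nonneg (by linarith [hlogN2'])] at this
      linarith
    have hlogN' : Real.log N ≤ (N : ℝ) ^ (2 * δ) := by
      have := hlogpowN; simp only [one_mul, pow_one] at this; exact this
    calc (Q : ℝ) = (maynardW N : ℝ) * ((⌊maynardR θ δ N⌋₊ : ℝ) * ⌊maynardR θ δ N⌋₊) := by
          rw [hQ]; push_cast; ring
      _ ≤ 4 ^ maynardD0 N * (N : ℝ) ^ (θ - 2 * δ) :=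
          mul_le_mul hW4 hR2 (by positivity) (by positivity)
      _ ≤ (N : ℝ) ^ (2 * δ) / 2 * (N : ℝ) ^ (θ - 2 * δ) := by
          gcongr; linarith
      _ = (N : ℝ) ^ θ / 2 := by
          rw [div_mul_eq_mul_div, ← Real.rpow_add hNpos]; ring_nf
      _ ≤ ((N : ℝ) / 2) ^ θ := by
          rw [Real.div_rpow hNpos.le (by norm_num), div_le_div_iff₀ (by norm_num) (Real.rpow_pos_of_pos (by norm_num) _)]
          have : (2 : ℝ) ^ θ ≤ 2 := by
            calc (2 : ℝ) ^ θ ≤ 2 ^ (1 : ℝ) := Real.rpow_le_rpow_of_exponent_le (by norm_num) hθ1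
              _ = 2 := Real.rpow_one 2
          have h0 : 0 ≤ (N : ℝ) ^ θ := by positivity
          nlinarith
      _ ≤ ((X1 h N m : ℕ) : ℝ) ^ θ := Real.rpow_le_rpow (by positivity) hX1lo hθ0.le
  have hQ2 : (Q : ℝ) ≤ ((X2 h N m : ℕ) : ℝ) ^ θ :=
    hQ1.trans (Real.rpow_le_rpow (Nat.cast_nonneg _) (by exact_mod_cast X1_le_X2 h N m) hθ0.le)
  have hsub1 : Finset.Icc 1 Q ⊆ Finset.Icc 1 ⌊((X1 h N m : ℕ) : ℝ) ^ θ⌋₊ :=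
    Finset.Icc_subset_Icc le_rfl (Nat.le_floor hQ1)
  have hsub2 : Finset.Icc 1 Q ⊆ Finset.Icc 1 ⌊((X2 h N m : ℕ) : ℝ) ^ θ⌋₊ :=
    Finset.Icc_subset_Icc le_rfl (Nat.le_floor hQ2)
  have hnn : ∀ (x : ℝ) q, 0 ≤ K ^ ω q * primeCountingAPErr x q := fun x q =>
    mul_nonneg (pow_nonneg hK _) (primeCountingAPErr_nonneg _ _)
  -- split, enlarge the ranges, apply the hypothesis, and bound `x/(log x)^A`
  have hb2 := div_log_rpow_le hA.le hN4 hX2lo hX2hi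
  have hb1 := div_log_rpow_le hA.le hN4 hX1lo hX1hi'
  calc ∑ q ∈ (Finset.Icc 1 Q).filter Squarefree, K ^ ω q *
        (primeCountingAPErr ((X2 h N m : ℕ) : ℝ) q + primeCountingAPErr ((X1 h N m : ℕ) : ℝ) q)
      ≤ ∑ q ∈ Finset.Icc 1 Q, K ^ ω q *
        (primeCountingAPErr ((X2 h N m : ℕ) : ℝ) q + primeCountingAPErr ((X1 h N m : ℕ) : ℝ) q) :=
        Finset.sum_le_sum_of_subset_of_nonneg (Finset.filter_subset _ _) fun q _ _ => by
          rw [mul_add]; exact add_nonneg (hnn _ q) (hnn _ q)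
    _ = ∑ q ∈ Finset.Icc 1 Q, K ^ ω q * primeCountingAPErr ((X2 h N m : ℕ) : ℝ) q +
        ∑ q ∈ Finset.Icc 1 Q, K ^ ω q * primeCountingAPErr ((X1 h N m : ℕ) : ℝ) q := by
        rw [← Finset.sum_add_distrib]; exact Finset.sum_congr rfl fun q _ => mul_add _ _ _
    _ ≤ ∑ q ∈ Finset.Icc 1 ⌊((X2 h N m : ℕ) : ℝ) ^ θ⌋₊, K ^ ω q * primeCountingAPErr ((X2 h N m : ℕ) : ℝ) q +
        ∑ q ∈ Finset.Icc 1 ⌊((X1 h N m : ℕ) : ℝ) ^ θ⌋₊, K ^ ω q * primeCountingAPErr ((X1 h N m : ℕ) : ℝ) q :=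
        add_le_add (Finset.sum_le_sum_of_subset_of_nonneg hsub2 fun q _ _ => hnn _ q)
          (Finset.sum_le_sum_of_subset_of_nonneg hsub1 fun q _ _ => hnn _ q)
    _ ≤ c * (((X2 h N m : ℕ) : ℝ) / Real.log ((X2 h N m : ℕ) : ℝ) ^ A) +
        c * (((X1 h N m : ℕ) : ℝ) / Real.log ((X1 h N m : ℕ) : ℝ) ^ A) := add_le_add hN2 hN1
    _ ≤ c * (3 * 2 ^ A * N / Real.log N ^ A) + c * (3 * 2 ^ A * N / Real.log N ^ A) := by gcongr
    _ = 2 * c * (3 * 2 ^ A) * N / Real.log N ^ A := by ring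

/-! ### The sizes of `L = Σ 1/φ`, `Z_g = Σ 1/g²` -/

/-- Eventually `L = Σ_{u ≤ R, u sq.free, (u,W)=1} 1/φ(u) ≤ (2 + B(2)) (φ(W)/W) log R` (as in the proof of
`maynard_lemma51_holds`). [cite: MaynardAnnals2015, proof of Lemma 5.1, (5.13) (the bound ∑_{u<R,(u,W)=1} μ(u)²/φ(u) ≪ φ(W) log R/W)] -/
theorem eventually_sum_inv_totient_le {θ δ : ℝ} (hη : 0 < θ / 2 - δ) :
    ∀ᶠ N : ℕ in atTop, ∑ n ∈ G1 (maynardW N) ⌊maynardR θ δ N⌋₊, 1 / (n.totient : ℝ) ≤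
      (2 + SquarefreeSums.bConst 2) *
        (((Nat.totient (maynardW N) : ℝ) / (maynardW N)) * Real.log (maynardR θ δ N)) := by
  set b := SquarefreeSums.bConst 2 with hb
  have hb0 : 0 < b := by rw [hb]; unfold SquarefreeSums.bConst; positivity
  filter_upwards [eventually_one_le_loglog, tendsto_maynardD0_atTop'.eventually_ge_atTop 3,
    eventually_two_le_maynardR hη,
    eventually_mul_loglog_pow_le_log (13 * b) 3 hη, eventually_ge_atTop 1] with N hll hD3 hR2 hE3 hN1
  have hD1 : 1 ≤ maynardD0 N := by omega
  have hDpos : (0 : ℝ) < maynardD0 N := by exact_mod_cast (show 0 < maynardD0 N by omega)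
  have hW0 : maynardW N ≠ 0 := primorial_ne_zero _
  have hDW : ∀ p, p.Prime → p ≤ maynardD0 N → p ∣ maynardW N := fun p hp hpD =>
    (Nat.Prime.dvd_primorial_iff hp).2 hpD
  have hR1 : 1 < maynardR θ δ N := by linarith
  have hB1 : 1 ≤ ⌊maynardR θ δ N⌋₊ := Nat.le_floor (by simp only [Nat.cast_one]; linarith)
  have hNpos : (0 : ℝ) < N := by exact_mod_cast hN1
  have hlogR : Real.log (maynardR θ δ N) = (θ / 2 - δ) * Real.log N := by rw [maynardR, Real.log_rpow hNpos]
  have hlogR0 : 0 < Real.log (maynardR θ δ N) := Real.log_pos hR1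
  have hlogB : Real.log ⌊maynardR θ δ N⌋₊ ≤ Real.log (maynardR θ δ N) :=
    Real.log_le_log (by exact_mod_cast (show 0 < ⌊maynardR θ δ N⌋₊ by omega)) (Nat.floor_le (by linarith))
  set φW := (Nat.totient (maynardW N) : ℝ) / maynardW N with hφW
  have hφW0 : 0 ≤ φW := by positivity
  have hφWD : 1 / (maynardD0 N : ℝ) ≤ φW := one_div_le_totient_primorial_div hD1
  have hK : (SquarefreeSums.harmErr (maynardW N) + 4) * b ≤ φW * Real.log (maynardR θ δ N) := by
    have h16 : (16 : ℝ) ^ maynardD0 N ≤ Real.log (Real.log N) ^ 3 :=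
      (pow_maynardD0_le (c := 16) (by norm_num) hll).trans (pow_le_pow_right₀ hll natCeil_log_sixteen_le)
    have hharm := harmErr_primorial_add_four_le hD1
    have hD2D : (maynardD0 N : ℝ) ≤ 2 ^ maynardD0 N := by exact_mod_cast (Nat.lt_two_pow_self).le
    have key : (SquarefreeSums.harmErr (maynardW N) + 4) * b * maynardD0 N ≤ Real.log (maynardR θ δ N) := by
      calc (SquarefreeSums.harmErr (maynardW N) + 4) * b * maynardD0 N
          ≤ (13 * 8 ^ maynardD0 N) * b * 2 ^ maynardD0 N := by
            gcongr; unfold maynardW; exact hharm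
        _ = 13 * b * 16 ^ maynardD0 N := by rw [show (16 : ℝ) = 8 * 2 by norm_num, mul_pow]; ring
        _ ≤ 13 * b * Real.log (Real.log N) ^ 3 := by gcongr
        _ ≤ (θ / 2 - δ) * Real.log N := hE3
        _ = Real.log (maynardR θ δ N) := hlogR.symm
    calc (SquarefreeSums.harmErr (maynardW N) + 4) * b
        = (SquarefreeSums.harmErr (maynardW N) + 4) * b * maynardD0 N * (1 / maynardD0 N) := by field_simp
      _ ≤ Real.log (maynardR θ δ N) * φW := mul_le_mul key hφWD (by positivity) hlogR0.le
      _ = φW * Real.log (maynardR θ δ N) := mul_comm _ _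
  have hsum := SquarefreeSums.abs_sum_inv_totient_sub_le hW0 hD1 hDW hB1
  rw [← G1] at hsum
  have h' := (abs_sub_le_iff.1 hsum).1
  have hD14 : (maynardD0 N : ℝ) ^ (-(1 : ℝ) / 4) ≤ 1 := Real.rpow_le_one_of_one_le_of_nonpos (by linarith [show (3:ℝ) ≤ maynardD0 N by exact_mod_cast hD3]) (by norm_num)
  calc ∑ n ∈ G1 (maynardW N) ⌊maynardR θ δ N⌋₊, 1 / (n.totient : ℝ)
      ≤ φW * Real.log ⌊maynardR θ δ N⌋₊ + ((SquarefreeSums.harmErr (maynardW N) + 4) * b +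
          φW * (b * (maynardD0 N : ℝ) ^ (-(1 : ℝ) / 4)) * Real.log ⌊maynardR θ δ N⌋₊) := by
        rw [hφW, hb]; linarith
    _ ≤ φW * Real.log (maynardR θ δ N) + (φW * Real.log (maynardR θ δ N) + φW * (b * 1) * Real.log (maynardR θ δ N)) := by
        gcongr
    _ = (2 + b) * (φW * Real.log (maynardR θ δ N)) := by ring

/-- Eventually `Z_g^K − 1 ≤ 4K·3^{K−1}/D₀` for `Z_g = Σ_{u ≤ R, u sq.free, (u,W)=1} 1/g(u)²` (Maynard's
"`∏ (1 + O(D₀⁻¹))`" in (5.19)–(5.20); from `SquarefreeSums.sum_inv_g_sq_sub_one_le`).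
[cite: MaynardAnnals2015, proof of Lemma 5.2, (5.19)–(5.20)] -/
theorem eventually_Zg_pow_sub_one_le {θ δ : ℝ} (hη : 0 < θ / 2 - δ) (K : ℕ) :
    ∀ᶠ N : ℕ in atTop,
      1 ≤ ∑ n ∈ G1 (maynardW N) ⌊maynardR θ δ N⌋₊, 1 / gAF n ^ 2 ∧
      (∑ n ∈ G1 (maynardW N) ⌊maynardR θ δ N⌋₊, 1 / gAF n ^ 2) ^ K - 1 ≤ (4 * K * 3 ^ (K - 1)) / (maynardD0 N : ℝ) := by
  filter_upwards [tendsto_maynardD0_atTop'.eventually_ge_atTop 4, eventually_two_le_maynardR hη] with N hD4 hR2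
  have hDr : (4 : ℝ) ≤ maynardD0 N := by exact_mod_cast hD4
  have hDpos : (0 : ℝ) < maynardD0 N := by linarith
  have hDW : ∀ p, p.Prime → p ≤ maynardD0 N → p ∣ maynardW N := fun p hp hpD =>
    (Nat.Prime.dvd_primorial_iff hp).2 hpD
  set Z := ∑ n ∈ G1 (maynardW N) ⌊maynardR θ δ N⌋₊, 1 / gAF n ^ 2 with hZ
  -- `Z − 1 ≤ 2/(D₀ − 2)` : the `n = 1` term is `1`, the others are in `sum_inv_g_sq_sub_one_le`
  have hZsub : Z - 1 ≤ 2 / ((maynardD0 N : ℝ) - 2) := by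
    have h := SquarefreeSums.sum_inv_g_sq_sub_one_le (W := maynardW N) (D₀ := maynardD0 N) (by omega) hDW
      ⌊maynardR θ δ N⌋₊
    have heq : ∑ n ∈ (Finset.Icc 1 ⌊maynardR θ δ N⌋₊).filter (fun n => Squarefree n ∧ n.Coprime (maynardW N)),
        1 / (∏ p ∈ n.primeFactors, ((p : ℝ) - 2)) ^ 2 = Z := by
      rw [hZ, G1]
      refine Finset.sum_congr rfl fun n hn => ?_
      rw [gAF_apply (by have := (Finset.mem_Icc.1 (Finset.mem_filter.1 hn).1).1; omega)]
    rw [heq] at h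
    exact h
  have hB : 1 ≤ ⌊maynardR θ δ N⌋₊ := Nat.le_floor (by simp only [Nat.cast_one]; linarith)
  have h1G : 1 ∈ G1 (maynardW N) ⌊maynardR θ δ N⌋₊ := by
    rw [mem_G1]; exact ⟨⟨le_rfl, hB⟩, squarefree_one, Nat.coprime_one_left _⟩
  have hZ1 : 1 ≤ Z := by
    have := Finset.single_le_sum (f := fun n : ℕ => 1 / gAF n ^ 2)
      (fun n hn => by positivity) h1G
    rw [← hZ] at this
    have hg1 : gAF 1 = 1 := by rw [gAF_apply one_ne_zero]; simp
    rw [hg1] at this; simpa using this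
  refine ⟨hZ1, ?_⟩
  have hZ4 : Z - 1 ≤ 4 / maynardD0 N := by
    refine hZsub.trans ?_
    rw [div_le_div_iff₀ (by linarith) hDpos]; linarith
  have hZ3 : Z ≤ 3 := by
    have : (4 : ℝ) / maynardD0 N ≤ 1 := by rw [div_le_one hDpos]; linarith
    linarith
  calc Z ^ K - 1 ≤ K * (Z - 1) * Z ^ (K - 1) := SquarefreeSums.pow_sub_one_le hZ1 K
    _ ≤ K * (4 / maynardD0 N) * 3 ^ (K - 1) := by gcongr
    _ = (4 * K * 3 ^ (K - 1)) / (maynardD0 N : ℝ) := by ring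

/-! ### Three more eventual facts: `D₀ ≤ log N`, the shifts, the range of `n + h_m` -/

/-- Eventually `D₀ ≤ log N` (indeed `4^{D₀} ≤ (log N)/2`). [folklore] -/
theorem eventually_maynardD0_le_log : ∀ᶠ N : ℕ in atTop, (maynardD0 N : ℝ) ≤ Real.log N := by
  have h4 := (isLittleO_pow_maynardD0_log (b := (4 : ℝ)) (by norm_num)).bound
    (show (0 : ℝ) < 1 / 2 by norm_num)
  filter_upwards [h4, (Real.tendsto_log_atTop.comp tendsto_natCast_atTop_atTop).eventually_ge_atTop
    (0 : ℝ)] with N h4N hlog0'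
  have hlog0 : 0 ≤ Real.log N := hlog0'
  have h4' : (4 : ℝ) ^ maynardD0 N ≤ 1 / 2 * Real.log N := by
    have := h4N
    rwa [Real.norm_of_nonneg (by positivity), Real.norm_of_nonneg hlog0] at this
  have hD4 : (maynardD0 N : ℝ) ≤ 4 ^ maynardD0 N := by
    have h1 : (maynardD0 N : ℝ) ≤ 2 ^ maynardD0 N := by exact_mod_cast (Nat.lt_two_pow_self).le
    exact h1.trans (pow_le_pow_left₀ (by norm_num) (by norm_num) _)
  linarith

/-- For distinct shifts, eventually every prime dividing some `hᵢ − hⱼ` (`i ≠ j`) divides `W`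
(`D₀ ≥ max |hᵢ − hⱼ|`). [cite: MaynardAnnals2015, proof of Lemma 5.1 ("since (dᵢ, eⱼ) | hᵢ − hⱼ, and D₀ is large")] -/
theorem eventually_dvd_maynardW_of_dvd_sub {k : ℕ} {h : Fin k → ℤ} (hinj : Function.Injective h) :
    ∀ᶠ N : ℕ in atTop, ∀ i j, i ≠ j → ∀ p : ℕ, p.Prime → (p : ℤ) ∣ h i - h j → p ∣ maynardW N := by
  obtain ⟨Hmax, hHmax⟩ : ∃ H : ℕ, ∀ i j, (h i - h j).natAbs ≤ H :=
    ⟨Finset.univ.sup fun p : Fin k × Fin k => (h p.1 - h p.2).natAbs, fun i j =>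
      Finset.le_sup (f := fun p : Fin k × Fin k => (h p.1 - h p.2).natAbs) (Finset.mem_univ (i, j))⟩
  filter_upwards [tendsto_maynardD0_atTop'.eventually_ge_atTop Hmax] with N hDH
  intro i j hij p hp hpd
  refine dvd_maynardW_of_prime_le hp (le_trans ?_ hDH)
  have hne : h i - h j ≠ 0 := sub_ne_zero.2 fun he => hij (hinj he)
  have h1 : p ∣ (h i - h j).natAbs := Int.natCast_dvd.1 hpd
  exact (Nat.le_of_dvd (Int.natAbs_pos.2 hne) h1).trans (hHmax i j)

/-- Eventually `1 ≤ N + h_m` and `⌊R⌋ < N + h_m` (`R = N^{θ/2−δ} ≤ N^{1/2} ≤ N/2` for `θ ≤ 1`).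
[folklore] -/
theorem eventually_floor_maynardR_lt {k : ℕ} (h : Fin k → ℤ) (m : Fin k) {θ δ : ℝ} (hδ : 0 < δ)
    (hθ1 : θ ≤ 1) :
    ∀ᶠ N : ℕ in atTop, 1 ≤ (N : ℤ) + h m ∧ (⌊maynardR θ δ N⌋₊ : ℤ) < N + h m := by
  filter_upwards [eventually_ge_atTop (2 * (h m).natAbs + 4)] with N hN
  have hHabs : |((h m : ℤ) : ℝ)| ≤ (N : ℝ) / 2 - 2 := by
    have h2 : (2 * (h m).natAbs + 4 : ℕ) ≤ (N : ℝ) := by exact_mod_cast hN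
    push_cast at h2
    rw [← Int.cast_abs, ← Nat.cast_natAbs]
    linarith
  have habs0 : 0 ≤ |((h m : ℤ) : ℝ)| := abs_nonneg _
  obtain ⟨hHlo, -⟩ := abs_le.1 hHabs
  have hN4 : (4 : ℝ) ≤ N := by linarith
  have hNpos : (0 : ℝ) < N := by linarith
  refine ⟨?_, ?_⟩
  · have : (1 : ℝ) ≤ (N : ℝ) + (h m : ℝ) := by linarith
    exact_mod_cast this
  · have hRle : maynardR θ δ N ≤ (N : ℝ) / 2 := by
      have hs : maynardR θ δ N ≤ (N : ℝ) ^ (1 / 2 : ℝ) := by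
        unfold maynardR
        exact Real.rpow_le_rpow_of_exponent_le (by linarith) (by linarith)
      obtain ⟨s, hsdef⟩ : ∃ s : ℝ, s = (N : ℝ) ^ (1 / 2 : ℝ) := ⟨_, rfl⟩
      rw [← hsdef] at hs
      have hsq : s * s = N := by
        rw [hsdef, ← Real.rpow_add hNpos, show (1 / 2 : ℝ) + 1 / 2 = 1 by norm_num, Real.rpow_one]
      have hs0 : 0 ≤ s := by rw [hsdef]; positivity
      have hs2 : 2 ≤ s := by
        by_contra hlt
        push Not at hlt
        have : s * s < 2 * 2 := mul_lt_mul'' hlt hlt hs0 hs0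
        linarith
      have h2s : 2 * s ≤ s * s := mul_le_mul_of_nonneg_right hs2 hs0
      linarith
    have hRpos : 0 ≤ maynardR θ δ N := by unfold maynardR; positivity
    have hfl : (⌊maynardR θ δ N⌋₊ : ℝ) ≤ maynardR θ δ N := Nat.floor_le hRpos
    have : ((⌊maynardR θ δ N⌋₊ : ℕ) : ℝ) < (N : ℝ) + (h m : ℝ) := by linarith
    exact_mod_cast this

/-! ### Bookkeeping inequalities for the assembly -/

/-- First error term of Lemma 5.2:
`(X/φ) Y² L_g^{j} (Z_g^K − 1) ≤ 2 C_g^{j} C_Z · Y² ρ^{j} ℓ^{j} N/(φ ℓ D)` when `X ≤ 2N/ℓ`,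
`L_g ≤ C_g ρ ℓ`, `Z_g^K − 1 ≤ C_Z/D`. [folklore] -/
theorem lemma52_term1_le {X N φ ℓ D Y Lg ZK ρ CLg CZ : ℝ} {j : ℕ}
    (hφ : 0 < φ) (hℓ : 0 < ℓ) (hD : 0 < D) (hN : 0 ≤ N) (hX : X ≤ 2 * N / ℓ)
    (hCLg : 0 ≤ CLg) (hρ : 0 ≤ ρ) (hLg0 : 0 ≤ Lg) (hLg : Lg ≤ CLg * ρ * ℓ) (hZ0 : 0 ≤ ZK)
    (hZ : ZK ≤ CZ / D) :
    X / φ * (Y ^ 2 * Lg ^ j * ZK) ≤ 2 * CLg ^ j * CZ * (Y ^ 2 * ρ ^ j * ℓ ^ j * N / (φ * ℓ * D)) := by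
  have hLgj : Lg ^ j ≤ (CLg * ρ * ℓ) ^ j := pow_le_pow_left₀ hLg0 hLg j
  have hP0 : 0 ≤ (CLg * ρ * ℓ) ^ j := pow_nonneg (mul_nonneg (mul_nonneg hCLg hρ) hℓ.le) j
  have h1 : X * Lg ^ j ≤ (2 * N / ℓ) * (CLg * ρ * ℓ) ^ j :=
    mul_le_mul hX hLgj (pow_nonneg hLg0 _) (by positivity)
  have h2 : X * Lg ^ j * ZK ≤ (2 * N / ℓ) * (CLg * ρ * ℓ) ^ j * (CZ / D) :=
    mul_le_mul h1 hZ hZ0 (mul_nonneg (by positivity) hP0)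
  have h3 : X * Lg ^ j * ZK * (Y ^ 2 / φ) ≤ (2 * N / ℓ) * (CLg * ρ * ℓ) ^ j * (CZ / D) * (Y ^ 2 / φ) :=
    mul_le_mul_of_nonneg_right h2 (by positivity)
  calc X / φ * (Y ^ 2 * Lg ^ j * ZK) = X * Lg ^ j * ZK * (Y ^ 2 / φ) := by ring
    _ ≤ (2 * N / ℓ) * (CLg * ρ * ℓ) ^ j * (CZ / D) * (Y ^ 2 / φ) := h3
    _ = 2 * CLg ^ j * CZ * (Y ^ 2 * ρ ^ j * ℓ ^ j * N / (φ * ℓ * D)) := by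
        rw [mul_pow, mul_pow]
        field_simp

/-- Second error term of Lemma 5.2:
`(G_max L^{2k})² S ≤ G_max² C_L^{4k} C_S · N/P` when `L ≤ C_L ℓ`, `S ≤ C_S N/(P ℓ^{4k})`. [folklore] -/
theorem lemma52_term2_le {N ℓ P L S Gmax CL CS : ℝ} {k : ℕ}
    (hℓ : 0 < ℓ) (hP : 0 < P) (hCL : 0 ≤ CL) (hL0 : 0 ≤ L) (hL : L ≤ CL * ℓ)
    (hS0 : 0 ≤ S) (hS : S ≤ CS * N / (P * ℓ ^ (4 * k))) :
    (Gmax * L ^ (2 * k)) ^ 2 * S ≤ Gmax ^ 2 * CL ^ (4 * k) * CS * (N / P) := by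
  have hL4 : L ^ (4 * k) ≤ (CL * ℓ) ^ (4 * k) := pow_le_pow_left₀ hL0 hL _
  have hsq : (Gmax * L ^ (2 * k)) ^ 2 = Gmax ^ 2 * L ^ (4 * k) := by ring
  rw [hsq]
  calc Gmax ^ 2 * L ^ (4 * k) * S ≤ Gmax ^ 2 * (CL * ℓ) ^ (4 * k) * (CS * N / (P * ℓ ^ (4 * k))) :=
        mul_le_mul (mul_le_mul_of_nonneg_left hL4 (sq_nonneg _)) hS hS0 (by positivity)
    _ = Gmax ^ 2 * CL ^ (4 * k) * CS * (N / P) := by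
        rw [mul_pow]
        field_simp

/-- Third error term of Lemma 5.2 (replacing `X_N` by `N/log N` in the main term):
`C_X N/(ℓ² φ) Σ ≤ C_X C_g^{j} · Y² ρ^{j} ℓ^{j} N/(φ ℓ D)` when `Σ ≤ Y² L_g^{j}`, `L_g ≤ C_g ρ ℓ`,
`D ≤ ℓ`. [folklore] -/
theorem lemma52_term3_le {N φ ℓ D Y Lg Sg ρ CLg CX : ℝ} {j : ℕ}
    (hφ : 0 < φ) (hℓ : 0 < ℓ) (hD : 0 < D) (hDℓ : D ≤ ℓ) (hN : 0 ≤ N) (hCX : 0 ≤ CX)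
    (hCLg : 0 ≤ CLg) (hρ : 0 ≤ ρ) (hSg : Sg ≤ Y ^ 2 * Lg ^ j) (hLg0 : 0 ≤ Lg)
    (hLg : Lg ≤ CLg * ρ * ℓ) :
    CX * N / ℓ ^ 2 / φ * Sg ≤ CX * CLg ^ j * (Y ^ 2 * ρ ^ j * ℓ ^ j * N / (φ * ℓ * D)) := by
  have hLgj : Lg ^ j ≤ (CLg * ρ * ℓ) ^ j := pow_le_pow_left₀ hLg0 hLg j
  have hSg' : Sg ≤ Y ^ 2 * (CLg * ρ * ℓ) ^ j := hSg.trans (mul_le_mul_of_nonneg_left hLgj (sq_nonneg _))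
  have h1 : CX * N / ℓ ^ 2 / φ * Sg ≤ CX * N / ℓ ^ 2 / φ * (Y ^ 2 * (CLg * ρ * ℓ) ^ j) :=
    mul_le_mul_of_nonneg_left hSg' (by positivity)
  have h2 : CX * N / ℓ ^ 2 / φ * (Y ^ 2 * (CLg * ρ * ℓ) ^ j) =
      CX * CLg ^ j * (Y ^ 2 * ρ ^ j * ℓ ^ j * N / (φ * ℓ)) * (1 / ℓ) := by
    rw [mul_pow, mul_pow]
    field_simp
  have h3 : CX * CLg ^ j * (Y ^ 2 * ρ ^ j * ℓ ^ j * N / (φ * ℓ * D)) =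
      CX * CLg ^ j * (Y ^ 2 * ρ ^ j * ℓ ^ j * N / (φ * ℓ)) * (1 / D) := by
    field_simp
  rw [h3]
  refine h1.trans ?_
  rw [h2]
  exact mul_le_mul_of_nonneg_left (one_div_le_one_div_of_le hD hDℓ) (by positivity)

/-- The final combination: `|M − (N/(φℓ)) Σ| ≤ |M − (X/φ) Σ| + |X − N/ℓ| Σ/φ`, and the three error
terms against `c₁ T + c₂ U + c₃ T ≤ (c₁ + c₃ + c₂)(T + U)`. [folklore] -/
theorem lemma52_combine {M X φ ℓ N Sg E₁ E₂ CX T U c₁ c₂ c₃ : ℝ} (hφ : 0 < φ)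
    (hmain : |M - X / φ * Sg| ≤ E₁ + E₂) (hCXN : |X - N / ℓ| ≤ CX * N / ℓ ^ 2) (hSg0 : 0 ≤ Sg)
    (hT1 : E₁ ≤ c₁ * T) (hT2 : E₂ ≤ c₂ * U) (hT3 : CX * N / ℓ ^ 2 / φ * Sg ≤ c₃ * T)
    (hc₁ : 0 ≤ c₁) (hc₂ : 0 ≤ c₂) (hc₃ : 0 ≤ c₃) (hT : 0 ≤ T) (hU : 0 ≤ U) :
    |M - N / (φ * ℓ) * Sg| ≤ (c₁ + c₃ + c₂) * (T + U) := by
  have hsplit : M - N / (φ * ℓ) * Sg = (M - X / φ * Sg) + (X - N / ℓ) / φ * Sg := by ring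
  have hsecond : |(X - N / ℓ) / φ * Sg| ≤ CX * N / ℓ ^ 2 / φ * Sg := by
    rw [abs_mul, abs_of_nonneg hSg0, abs_div, abs_of_pos hφ]
    gcongr
  rw [hsplit]
  calc _ ≤ |M - X / φ * Sg| + |(X - N / ℓ) / φ * Sg| := abs_add_le _ _
    _ ≤ c₁ * T + c₂ * U + c₃ * T := by linarith
    _ ≤ c₁ * T + c₂ * U + c₃ * T + (c₁ * U + c₃ * U + c₂ * T) := le_add_of_nonneg_right (by positivity)
    _ = (c₁ + c₃ + c₂) * (T + U) := by ring

end MaynardSieve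

/-! ### The diagonal sum is `≪ Y² L_g^{k−1}` -/

/-- `0 ≤ Σ_r (y^{(m)}_r)²/∏ g(rᵢ) ≤ Y² (Σ_{u ≤ R good} 1/g(u))^{k−1}` when `|y^{(m)}_r| ≤ Y` on the box
and `W` is even: `y^{(m)}_r` vanishes unless `r` is a good tuple with `r_m = 1`, on good tuples
`g(rᵢ) > 0`, and `sum_prod_inv_maynardG_le`. [cite: MaynardAnnals2015, proof of Lemma 5.2 (the bound (y^(m)_max)² (∑_{u<R,(u,W)=1} μ(u)²/g(u))^{k−1})] -/
theorem sum_maynardYm_sq_div_bounds {k W : ℕ} (hW : 2 ∣ W) (F : (Fin k → ℝ) → ℝ) (R : ℝ)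
    (m : Fin k) {Y : ℝ} (hY : ∀ r ∈ maynardBox k R, |maynardYm k F R W m r| ≤ Y) :
    0 ≤ ∑ r ∈ maynardBox k R, maynardYm k F R W m r ^ 2 / ∏ i, maynardG (r i) ∧
      ∑ r ∈ maynardBox k R, maynardYm k F R W m r ^ 2 / ∏ i, maynardG (r i) ≤
        Y ^ 2 * (∑ u ∈ MaynardSieve.G1 W ⌊R⌋₊, 1 / maynardG u) ^ (k - 1) := by
  classical
  -- termwise comparison with `Y² [r_m = 1, r good] ∏ 1/g(rᵢ)`
  have hterm : ∀ r ∈ maynardBox k R,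
      0 ≤ maynardYm k F R W m r ^ 2 / ∏ i, maynardG (r i) ∧
      maynardYm k F R W m r ^ 2 / ∏ i, maynardG (r i) ≤
        if r m = 1 ∧ Squarefree (∏ i, r i) ∧ Nat.Coprime (∏ i, r i) W then
          Y ^ 2 * ∏ i, 1 / maynardG (r i) else 0 := by
    intro r hr
    by_cases hG : r ∈ MaynardSieve.boxG k W ⌊R⌋₊
    · have hgpos : ∀ i, 0 < maynardG (r i) := fun i => maynardG_pos_of_mem_boxG hW hG i
      have hpos : 0 < ∏ i, maynardG (r i) := Finset.prod_pos fun i _ => hgpos i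
      have hgood : Squarefree (∏ i, r i) ∧ Nat.Coprime (∏ i, r i) W := (MaynardSieve.mem_boxG.1 hG).2
      refine ⟨by positivity, ?_⟩
      by_cases hm : r m = 1
      · rw [if_pos ⟨hm, hgood⟩]
        have hsq : maynardYm k F R W m r ^ 2 ≤ Y ^ 2 := by
          rw [← sq_abs]
          exact pow_le_pow_left₀ (abs_nonneg _) (hY r hr) 2
        have hprod : ∏ i, 1 / maynardG (r i) = 1 / ∏ i, maynardG (r i) := by
          simp only [one_div, Finset.prod_inv_distrib]
        rw [hprod, div_eq_mul_one_div]
        exact mul_le_mul_of_nonneg_right hsq (by positivity)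
      · rw [maynardYm_eq_zero_of_ne_one F R W m hm]
        have h0 : (0 : ℝ) ^ 2 / ∏ i, maynardG (r i) = 0 := by simp
        rw [h0]
        split_ifs
        · exact mul_nonneg (sq_nonneg _) (Finset.prod_nonneg fun i _ => by
            have := hgpos i; positivity)
        · exact le_rfl
    · rw [maynardYm_eq_zero_of_not_mem_boxG F R W m hG]
      have h0 : (0 : ℝ) ^ 2 / ∏ i, maynardG (r i) = 0 := by simp
      rw [h0]
      refine ⟨le_rfl, ?_⟩
      split_ifs with hc
      · exact absurd (MaynardSieve.mem_boxG.2 ⟨MaynardSieve.mem_box.2 (mem_maynardBox_iff.1 hr), hc.2⟩) hG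
      · exact le_rfl
  refine ⟨Finset.sum_nonneg fun r hr => (hterm r hr).1, ?_⟩
  calc ∑ r ∈ maynardBox k R, maynardYm k F R W m r ^ 2 / ∏ i, maynardG (r i)
      ≤ ∑ r ∈ maynardBox k R,
          (if r m = 1 ∧ Squarefree (∏ i, r i) ∧ Nat.Coprime (∏ i, r i) W then
            Y ^ 2 * ∏ i, 1 / maynardG (r i) else 0) := Finset.sum_le_sum fun r hr => (hterm r hr).2
    _ = Y ^ 2 * ∑ r ∈ (maynardBox k R).filter
          (fun r => r m = 1 ∧ Squarefree (∏ i, r i) ∧ Nat.Coprime (∏ i, r i) W),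
            ∏ i, 1 / maynardG (r i) := by
        rw [Finset.sum_filter, Finset.mul_sum]
        refine Finset.sum_congr rfl fun r _ => ?_
        split_ifs <;> simp
    _ ≤ Y ^ 2 * (∑ u ∈ MaynardSieve.G1 W ⌊R⌋₊, 1 / maynardG u) ^ (k - 1) :=
        mul_le_mul_of_nonneg_left (sum_prod_inv_maynardG_le hW R m) (sq_nonneg _)

/-- On the good scalars `maynardG = gAF`, so the two one-variable `g`-sums agree. [folklore] -/
theorem sum_inv_maynardG_eq_sum_inv_gAF (W B : ℕ) :
    ∑ u ∈ MaynardSieve.G1 W B, 1 / maynardG u = ∑ u ∈ MaynardSieve.G1 W B, 1 / MaynardSieve.gAF u :=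
  Finset.sum_congr rfl fun u hu => by rw [maynardG_eq_gAF_of_squarefree (MaynardSieve.mem_G1.1 hu).2.1]

/-! ### Lemma 5.2 assembled: the named fact `maynard_lemma52` -/

/-- **Maynard 2015, Lemma 5.2** — the named fact `Literature.NumberTheory.Sieve.maynard_lemma52` (`MaynardSieveS2.lean`)
DISCHARGED: for `λ = maynardWeight` with `F = G · 1_{R_k}`, `G` continuous, distinct shifts, a level
of distribution `θ` in Maynard's sense, `0 < δ`, `0 < θ/2 − δ`, residues `v₀(N)` with
`(v₀ + hᵢ, W) = 1`, and any eventual majorant `Y(N) ≥ |y^{(m)}_r|`,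
`S₂^{(m)} − N/(φ(W) log N) Σ_r (y^{(m)}_r)²/∏ g(rᵢ) = O(Y² (φ(W)/W)^{k−1} (log N)^{k−1} N/(φ(W) (log N) D₀) + N/(log N)^A)`.
Assembly of the non-asymptotic `abs_maynardS2_sub_main_le` (`MaynardSieveCounting2.lean`:
(5.16)–(5.17), the CRT count, the diagonalisation (5.18)–(5.26), the regrouping of the error by the
modulus) with: `X_N = N/log N + O(N/log² N)` (`exists_eventually_abs_primesX_sub_le`, de la Vallée
Poussin), the level-of-distribution hypothesis at `x = X₂, X₁` with weight `(4^k)^{ω(q)}` and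
exponent `A + 4k` (`exists_eventually_level_sum_le`), `L ≤ C (φ(W)/W) log R`
(`eventually_sum_inv_totient_le`), `L_g ≤ C (φ(W)/W) log R` (`eventually_sum_inv_maynardG_le`),
`Z_g^{k²−k} − 1 ≪ 1/D₀` (`eventually_Zg_pow_sub_one_le`), and `D₀ ≤ log N`.
[cite: MaynardAnnals2015, Lemma 5.2] -/
theorem maynard_lemma52_holds : maynard_lemma52 := by
  intro k h hinj θ δ hδ hη hlev G hG v₀ hv₀ m Y hY A hA
  classical
  have hθ1 : θ ≤ 1 := hlev.le_one
  -- `G` is bounded on the simplex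
  obtain ⟨Gmax, hG0, hGmax⟩ : ∃ M : ℝ, 0 ≤ M ∧ ∀ x ∈ maynardSimplex k, |G x| ≤ M := by
    obtain ⟨M, hM⟩ := (isCompact_maynardSimplex k).exists_bound_of_continuousOn hG.continuousOn
    exact ⟨max M 0, le_max_right _ _, fun x hx => (hM x hx).trans (le_max_left _ _)⟩
  -- constants (opaque names)
  obtain ⟨K, hK⟩ : ∃ K : ℕ, K = Fintype.card (MaynardSieve.OffDiag k) := ⟨_, rfl⟩
  obtain ⟨CL, hCL⟩ : ∃ C : ℝ, C = 2 + SquarefreeSums.bConst 2 := ⟨_, rfl⟩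
  obtain ⟨CLg, hCLg⟩ : ∃ C : ℝ, C = 2 + SquarefreeSums.bConst 6 := ⟨_, rfl⟩
  obtain ⟨CZ, hCZ⟩ : ∃ C : ℝ, C = 4 * K * 3 ^ (K - 1) := ⟨_, rfl⟩
  have hb2 : 0 < SquarefreeSums.bConst 2 := by unfold SquarefreeSums.bConst; positivity
  have hb6 : 0 < SquarefreeSums.bConst 6 := by unfold SquarefreeSums.bConst; positivity
  have hCL0 : 0 ≤ CL := by rw [hCL]; positivity
  have hCLg0 : 0 ≤ CLg := by rw [hCLg]; positivity
  have hCZ0 : 0 ≤ CZ := by rw [hCZ]; positivity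
  -- `X_N = N/log N + O(N/log² N)` and the level-of-distribution input
  obtain ⟨CX', hCXev⟩ := MaynardSieve.exists_eventually_abs_primesX_sub_le h m
  obtain ⟨CS', hCSev⟩ := MaynardSieve.exists_eventually_level_sum_le h m hδ hη hlev
    (K := (4 : ℝ) ^ k) (by positivity) (A := A + 4 * k) (by positivity)
  obtain ⟨CX, hCX⟩ : ∃ C : ℝ, C = max CX' 0 := ⟨_, rfl⟩
  obtain ⟨CS, hCS⟩ : ∃ C : ℝ, C = max CS' 0 := ⟨_, rfl⟩
  have hCX0 : 0 ≤ CX := by rw [hCX]; exact le_max_right _ _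
  have hCS0 : 0 ≤ CS := by rw [hCS]; exact le_max_right _ _
  have hCX' : CX' ≤ CX := by rw [hCX]; exact le_max_left _ _
  have hCS' : CS' ≤ CS := by rw [hCS]; exact le_max_left _ _
  have hlogT : Tendsto (fun N : ℕ => Real.log N) atTop atTop :=
    Real.tendsto_log_atTop.comp tendsto_natCast_atTop_atTop
  refine Asymptotics.IsBigO.of_bound
    (2 * CLg ^ (k - 1) * CZ + CX * CLg ^ (k - 1) + Gmax ^ 2 * CL ^ (4 * k) * CS) ?_
  filter_upwards [hY, hCXev, hCSev, MaynardSieve.eventually_sum_inv_totient_le hη,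
    eventually_sum_inv_maynardG_le hη, MaynardSieve.eventually_Zg_pow_sub_one_le hη K,
    MaynardSieve.eventually_two_le_maynardR hη, eventually_two_le_maynardD0,
    MaynardSieve.eventually_maynardD0_le_log, MaynardSieve.eventually_dvd_maynardW_of_dvd_sub hinj,
    MaynardSieve.eventually_floor_maynardR_lt h m hδ hθ1, hlogT.eventually_ge_atTop (max 2 CX)]
    with N hYN hCXN hCSN hLN hLgN hZN hR2 hD2 hDℓ hh hNB hlogN
  -- basic facts on `N, D₀, W, R`
  have hlog2 : 2 ≤ Real.log N := le_of_max_le_left hlogN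
  have hlogCX : CX ≤ Real.log N := le_of_max_le_right hlogN
  have hDpos : (0 : ℝ) < maynardD0 N := by exact_mod_cast (show 0 < maynardD0 N by omega)
  have hW0 : maynardW N ≠ 0 := primorial_ne_zero _
  have hWpos : (0 : ℝ) < maynardW N := by exact_mod_cast primorial_pos _
  have hW2 : 2 ∣ maynardW N := dvd_maynardW_of_prime_le Nat.prime_two hD2
  have hWsq : Squarefree (maynardW N) := by unfold maynardW; exact squarefree_primorial _
  have hφpos : (0 : ℝ) < Nat.totient (maynardW N) := by
    exact_mod_cast Nat.totient_pos.2 (primorial_pos _)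
  have hℓpos : 0 < Real.log N := by linarith
  have hNpos : (0 : ℝ) < N := by
    by_contra hle
    push Not at hle
    have hN0 : (N : ℝ) = 0 := le_antisymm hle (Nat.cast_nonneg _)
    rw [hN0, Real.log_zero] at hℓpos
    exact lt_irrefl _ hℓpos
  have hN1 : 1 ≤ N := by exact_mod_cast (show 0 < N by exact_mod_cast hNpos)
  have hR1 : 1 < maynardR θ δ N := by linarith
  have hlogR : Real.log (maynardR θ δ N) = (θ / 2 - δ) * Real.log N := log_maynardR hN1
  have hlogRle : Real.log (maynardR θ δ N) ≤ Real.log N := by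
    rw [hlogR]; exact mul_le_of_le_one_left hℓpos.le (by linarith)
  have hlogR0 : 0 < Real.log (maynardR θ δ N) := Real.log_pos hR1
  -- the combinatorial Lemma 5.2
  have hmain := abs_maynardS2_sub_main_le h G hR1 hW0 hW2 hWsq hG0 hGmax hh (hv₀ N m) hNB.1 hNB.2 hYN
  -- opaque names
  obtain ⟨L, hLdef⟩ : ∃ L : ℝ,
      L = ∑ n ∈ MaynardSieve.G1 (maynardW N) ⌊maynardR θ δ N⌋₊, 1 / (n.totient : ℝ) := ⟨_, rfl⟩
  obtain ⟨Lg, hLgdef⟩ : ∃ L : ℝ,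
      L = ∑ n ∈ MaynardSieve.G1 (maynardW N) ⌊maynardR θ δ N⌋₊, 1 / MaynardSieve.gAF n := ⟨_, rfl⟩
  obtain ⟨Zg, hZgdef⟩ : ∃ Z : ℝ,
      Z = ∑ n ∈ MaynardSieve.G1 (maynardW N) ⌊maynardR θ δ N⌋₊, 1 / MaynardSieve.gAF n ^ 2 :=
    ⟨_, rfl⟩
  obtain ⟨S, hSdef⟩ : ∃ S : ℝ,
      S = ∑ q ∈ (Finset.Icc 1 (maynardW N * (⌊maynardR θ δ N⌋₊ * ⌊maynardR θ δ N⌋₊))).filter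
          Squarefree,
        ((4 : ℝ) ^ k) ^ ω q * (primeCountingAPErr ((MaynardSieve.X2 h N m : ℕ) : ℝ) q +
          primeCountingAPErr ((MaynardSieve.X1 h N m : ℕ) : ℝ) q) := ⟨_, rfl⟩
  obtain ⟨Sg, hSgdef⟩ : ∃ S : ℝ,
      S = ∑ r ∈ maynardBox k (maynardR θ δ N),
        maynardYm k ((maynardSimplex k).indicator G) (maynardR θ δ N) (maynardW N) m r ^ 2 /
          ∏ i, maynardG (r i) := ⟨_, rfl⟩
  obtain ⟨X, hXdef⟩ : ∃ X : ℝ, X = (MaynardSieve.primesX h N m : ℝ) := ⟨_, rfl⟩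
  obtain ⟨ρ, hρdef⟩ : ∃ x : ℝ, x = (Nat.totient (maynardW N) : ℝ) / maynardW N := ⟨_, rfl⟩
  obtain ⟨φ, hφdef⟩ : ∃ x : ℝ, x = (Nat.totient (maynardW N) : ℝ) := ⟨_, rfl⟩
  obtain ⟨ℓ, hℓdef⟩ : ∃ x : ℝ, x = Real.log N := ⟨_, rfl⟩
  obtain ⟨D, hDdef⟩ : ∃ x : ℝ, x = (maynardD0 N : ℝ) := ⟨_, rfl⟩
  have hmain' : |maynardS2 k h ((maynardSimplex k).indicator G) (maynardR θ δ N) (maynardW N) (v₀ N) N m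
      - X / φ * Sg| ≤ X / φ * (Y N ^ 2 * Lg ^ (k - 1) * (Zg ^ K - 1)) + (Gmax * L ^ (2 * k)) ^ 2 * S := by
    rw [hXdef, hφdef, hSgdef, hLgdef, hZgdef, hK, hLdef, hSdef]; exact hmain
  have hCXN' : |X - N / ℓ| ≤ CX * N / ℓ ^ 2 := by
    rw [hXdef, hℓdef]
    refine hCXN.trans ?_
    gcongr
  have hCSN' : S ≤ CS' * N / ℓ ^ (A + 4 * (k : ℝ)) := by rw [hSdef, hℓdef]; exact hCSN
  have hLN' : L ≤ (2 + SquarefreeSums.bConst 2) * (ρ * Real.log (maynardR θ δ N)) := by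
    rw [hLdef, hρdef]; exact hLN
  have hLgN' : Lg ≤ (2 + SquarefreeSums.bConst 6) * (ρ * Real.log (maynardR θ δ N)) := by
    rw [hLgdef, hρdef, ← sum_inv_maynardG_eq_sum_inv_gAF]; exact hLgN
  have hZN' : 1 ≤ Zg ∧ Zg ^ K - 1 ≤ CZ / D := by rw [hZgdef, hCZ, hDdef]; exact hZN
  have hφpos' : 0 < φ := by rw [hφdef]; exact hφpos
  have hℓpos' : 0 < ℓ := by rw [hℓdef]; exact hℓpos
  have hDpos' : 0 < D := by rw [hDdef]; exact hDpos
  have hDℓ' : D ≤ ℓ := by rw [hDdef, hℓdef]; exact hDℓ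
  have hlogCX' : CX ≤ ℓ := by rw [hℓdef]; exact hlogCX
  have hlogRle' : Real.log (maynardR θ δ N) ≤ ℓ := by rw [hℓdef]; exact hlogRle
  -- the goal in the opaque names
  have hgoal : ‖maynardS2 k h ((maynardSimplex k).indicator G) (maynardR θ δ N) (maynardW N) (v₀ N) N m
        - (N : ℝ) / (φ * ℓ) * Sg‖ ≤
      (2 * CLg ^ (k - 1) * CZ + CX * CLg ^ (k - 1) + Gmax ^ 2 * CL ^ (4 * k) * CS) *
        ‖Y N ^ 2 * ρ ^ (k - 1) * ℓ ^ (k - 1) * N / (φ * ℓ * D) + N / ℓ ^ A‖ := by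
    -- signs and sizes
    have hρ0 : 0 ≤ ρ := by rw [hρdef]; positivity
    have hρ1 : ρ ≤ 1 := by
      rw [hρdef, div_le_one hWpos]; exact_mod_cast Nat.totient_le _
    have hL0 : 0 ≤ L := by rw [hLdef]; exact Finset.sum_nonneg fun _ _ => by positivity
    have hLg0 : 0 ≤ Lg := by
      rw [hLgdef]
      exact Finset.sum_nonneg fun n hn => by
        have := MaynardSieve.gAF_pos_of_mem_G1 hW2 hn; positivity
    have hS0 : 0 ≤ S := by
      rw [hSdef]
      exact Finset.sum_nonneg fun q _ => mul_nonneg (pow_nonneg (by positivity) _)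
        (add_nonneg (primeCountingAPErr_nonneg _ _) (primeCountingAPErr_nonneg _ _))
    obtain ⟨hSg0, hSgle⟩ := sum_maynardYm_sq_div_bounds hW2 ((maynardSimplex k).indicator G)
      (maynardR θ δ N) m hYN
    rw [← hSgdef] at hSg0
    rw [← hSgdef, sum_inv_maynardG_eq_sum_inv_gAF, ← hLgdef] at hSgle
    -- `L ≤ CL ℓ`, `Lg ≤ CLg ρ ℓ`
    have hL : L ≤ CL * ℓ := by
      refine hLN'.trans ?_
      rw [← hCL]
      calc CL * (ρ * Real.log (maynardR θ δ N)) ≤ CL * (1 * ℓ) := by gcongr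
        _ = CL * ℓ := by rw [one_mul]
    have hLg : Lg ≤ CLg * ρ * ℓ := by
      refine hLgN'.trans ?_
      rw [← hCLg, mul_assoc]
      gcongr
    -- `Zg^K − 1`
    obtain ⟨hZ1, hZK⟩ := hZN'
    have hZK0 : 0 ≤ Zg ^ K - 1 := by linarith [one_le_pow₀ (M₀ := ℝ) hZ1 (n := K)]
    -- `X ≤ 2N/ℓ`
    have hX2 : X ≤ 2 * N / ℓ := by
      have h1 : X ≤ N / ℓ + CX * N / ℓ ^ 2 := by linarith [(abs_le.1 hCXN').2]
      have h2 : CX * N / ℓ ^ 2 ≤ N / ℓ := by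
        rw [div_le_div_iff₀ (by positivity) hℓpos']
        calc CX * N * ℓ ≤ ℓ * N * ℓ := by gcongr
          _ = N * ℓ ^ 2 := by ring
      rw [mul_div_assoc]
      linarith
    -- `S ≤ CS N/(ℓ^A ℓ^{4k})`
    have hℓA : 0 < ℓ ^ A := Real.rpow_pos_of_pos hℓpos' A
    have hSle : S ≤ CS * N / (ℓ ^ A * ℓ ^ (4 * k)) := by
      refine hCSN'.trans ?_
      have hsplit : ℓ ^ (A + 4 * (k : ℝ)) = ℓ ^ A * ℓ ^ (4 * k) := by
        rw [Real.rpow_add hℓpos', show (4 * (k : ℝ)) = ((4 * k : ℕ) : ℝ) by push_cast; ring,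
          Real.rpow_natCast]
      rw [hsplit]
      gcongr
    -- the three terms and the combination
    have hT1 := MaynardSieve.lemma52_term1_le (Y := Y N) (j := k - 1) hφpos' hℓpos' hDpos' hNpos.le
      hX2 hCLg0 hρ0 hLg0 hLg hZK0 hZK
    have hT2 := MaynardSieve.lemma52_term2_le (Gmax := Gmax) (k := k) hℓpos' hℓA hCL0 hL0 hL hS0 hSle
    have hT3 := MaynardSieve.lemma52_term3_le (Y := Y N) (j := k - 1) hφpos' hℓpos' hDpos' hDℓ'
      hNpos.le hCX0 hCLg0 hρ0 hSgle hLg0 hLg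
    have hTT0 : 0 ≤ Y N ^ 2 * ρ ^ (k - 1) * ℓ ^ (k - 1) * N / (φ * ℓ * D) := by positivity
    have hU0 : 0 ≤ (N : ℝ) / ℓ ^ A := by positivity
    have hc1 : 0 ≤ 2 * CLg ^ (k - 1) * CZ := by positivity
    have hc3 : 0 ≤ CX * CLg ^ (k - 1) := by positivity
    have hc2 : 0 ≤ Gmax ^ 2 * CL ^ (4 * k) * CS := by positivity
    rw [Real.norm_eq_abs, Real.norm_eq_abs, abs_of_nonneg (add_nonneg hTT0 hU0)]
    exact MaynardSieve.lemma52_combine hφpos' hmain' hCXN' hSg0 hT1 hT2 hT3 hc1 hc2 hc3 hTT0 hU0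
  rw [hSgdef, hρdef, hφdef, hℓdef, hDdef] at hgoal
  exact hgoal

end Literature.NumberTheory.Sieve
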